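import Summits.BirchSwinnertonDyer.BirchSwinnertonDyer.Theorems.GenusKolyvaginAtTwoGenusPrimitiveSupplyAtTwoTwistingPrimeLevelFourClassFrobenius
import Summits.BirchSwinnertonDyer.BirchSwinnertonDyer.Theorems.GenusKolyvaginAtTwoGenusPrimitiveSupplyAtTwoTwistingPrimeEntangledDisentangled
import Literature.NumberTheory.Automorphic.ChebotarevArtinRepHolds
import HarnessLib

/-!
# Route `GenusKolyvaginAtTwo`, crux #2 `GenusPrimitiveSupplyAtTwo` (stmt-BirchSwinnertonDyer-22136):
# ENTANGLED MINIMAL PRIME HEEGNER TWINS EXIST FOR EVERY SELMER-ENTANGLED ROW-1 CURVE (Čebotarev at level `4`, proved)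

Width seat `bsd-line-gk2-p4` g10, cell `bsd-f1-sign2`; helper (`--supports stmt-BirchSwinnertonDyer-22136`), §53 of the twisting-prime
series (after `…LevelFourClassFrobenius` §52 and `…EntangledDisentangled` §50). THEOREMS ONLY: no definition, no named fact beyond the
displayed hypotheses, no `sorry`; no item is closed; BSD is not proved by this.

WHY. §50 showed that the ENTANGLED exception of the depth-`M` road (memo `Lines/genus-supply-depth-class.md` §2; DES13: 2/510 twins) never
blocks the `∃K`-supply. §52 showed that at a twisting prime whose Frobenius squares into `Γ_{ℚ(E[4])}` entanglement is decided by `W`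
alone («`W` Selmer-entangled»: a non-zero `2`-Selmer class dies on `Γ_{ℚ(E[4])}`). This file proves that the exception is REAL and
INFINITE for every Selmer-entangled row-1 curve: g7's twisting-prime Čebotarev argument run at level `4`.

* §53a `exists_torsionFixing_four_smul_h1Eval_ne` (key lemma at level `4`): for `x ∈ H¹(ℚ, E[2])` NOT dying on `Γ_{ℚ(E[4])}` (`ρ̄_{W,2}`
  onto, `Δ_W < 0`), a complex conjugation `c₀` and a root of unity `ζ`, some `h ∈ Γ_{ℚ(E[4], ζ)}` has `c₀[x, h] ≠ [x, h]`.
* §53b `exists_twistingPrime_sq_mem_torsionFixing_four`: twisting primes `ℓ > b`, `ℓ ∤ m`, `m ∣ ℓ + 1` for such `x`, whose Frobenius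
  `F ∈ c₀ · Γ_{ℚ(E[4], μ_m)}` acts on `E[2]` as `c₀` AND has `F² ∈ Γ_{ℚ(E[4])}`, with `x_ℓ ≠ 0` (`[x, F²] = c₀[x, h₀] + [x, h₀] ≠ 0`).
* §53c **`exists_prime_heegnerField_minimalTwin_entangled_of_selmer_entangled`**: `W/ℚ` globally minimal, `Δ_W < 0`, `ρ̄_{W,2}`, `ρ_{W,4}`
  onto, `#Sel₂(W) = 4`, and SELMER-ENTANGLED; displayed facts: Poitou–Tate duality, Tate's local Euler characteristic (as in §50). Then
  beyond every bound there is a prime Heegner field `ℚ(√−ℓ₀)` with ALL `K`-clauses of 22136 (`2` split, DEF = 1) and a globally minimal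
  `2`-Selmer-minimal twin `Wd` that IS ENTANGLED: `Γ_{ℚ(E[4])}` fixes every half `Q` of every `P ∈ Wd(ℚ) ∖ 2Wd(ℚ)` (no `E[2]`-translate
  of `Q` rational) — the twin's point condition of the depth-`M` supply (p623549, p630619, p635067) FAILS at these `K`. Proof: twisting
  prime (§53b) for a Selmer class `c` NOT dying on `Γ_{ℚ(E[4])}` (g8: one exists) ⟹ `Sel₂(W)` non-strict at `ℓ₀` ⟹ minimal twin
  (gk2-p5's DOWN supply) ⟹ entangled by §52c (`F² ∈ Γ_{ℚ(E[4])}`, `F` moves `E[2]`).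
NET for U (24947): the auxiliary-field form's «∀ large K» readings are FALSE for Selmer-entangled curves (a positive-density set of
prime Heegner fields is entangled), while the «∃K» reading holds for every row-1 curve (§50). BSD is not proved by any of this.

References: [MazurRubin2010] Prop. 3.3, Cor. 3.4 (i), Lemma 3.5; [GrossLMS1991] §9 Prop. 9.1, 9.6; [McCallumLMS1991] §3;
[LawsonWuthrich2016] §3; [SerreAbelianLadic1968] I §2.2.
-/

set_option linter.dupNamespace false -- tree convention: `Summit.BirchSwinnertonDyer.BirchSwinnertonDyer.Theorems` (summit = sub-problem)
set_option autoImplicit false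

noncomputable section

open scoped Classical Pointwise

namespace Summit.BirchSwinnertonDyer.BirchSwinnertonDyer.Theorems.GenusKolyTwistingPrime

open WeierstrassCurve NumberField IsDedekindDomain Field
open Literature.NumberTheory.GaloisRepresentations Literature.NumberTheory.EllipticCurves
open Literature.NumberTheory Literature.NumberTheory.GaloisCohomology

/-! ## §53a The key lemma at level `4` -/

section Key

variable (W : WeierstrassCurve ℚ) [W.IsElliptic]

/-- **KEY LEMMA AT LEVEL `4`.** For `x ∈ H¹(ℚ, E[2])` NOT dying on `Γ_{ℚ(E[4])}` (`ρ̄_{W,2}` onto, `Δ_W < 0`), a complex conjugation `c₀`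
and a root of unity `ζ`: some `h ∈ Γ_{ℚ(E[4])}` fixing `ζ` has `c₀ • [x, h] ≠ [x, h]`. (The values `[x, h]`, `h ∈ Γ_{ℚ(E[4], ζ)}`, form a
`Γ_ℚ`-stable subgroup of `E[2]`; it is non-zero — else every `[x, ρ]`, `ρ ∈ Γ_{ℚ(E[4])}`, is `Γ_ℚ`-fixed (commutators `γργ⁻¹ρ⁻¹` lie in
`Γ_{ℚ(E[4], ζ)}`), hence `0`, contradicting the hypothesis — so it is all of `E[2]` by transitivity, and `c₀` moves a `2`-torsion point
when `Δ < 0`.) g7's `exists_torsionFixing_smul_h1Eval_ne` with `E[4]` for `E[2]`. [cite: MazurRubin2010, Lemma 3.5 and Prop. 3.3]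
[cite: GrossLMS1991, §9 Prop. 9.1] -/
theorem exists_torsionFixing_four_smul_h1Eval_ne (hsurj : W.HasSurjectiveModNGaloisRep 2)
    (hΔ : W.Δ < 0) {c₀ : absoluteGaloisGroup ℚ} (hc₀ : IsComplexConjugation (Rat.castHom ℝ) c₀)
    {x : galH1Torsion W (2 : ℤ)} (hx : ∃ h ∈ torsionFixing W (4 : ℤ), h1Eval W (2 : ℤ) x h ≠ 0)
    {m : ℕ} [NeZero m] {ζ : AlgebraicClosure ℚ} (hζ : IsPrimitiveRoot ζ m) :
    ∃ h ∈ torsionFixing W (4 : ℤ), h • ζ = ζ ∧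
      c₀ • h1Eval W (2 : ℤ) x h ≠ h1Eval W (2 : ℤ) x h := by
  have hT42 : torsionFixing W (4 : ℤ) ≤ torsionFixing W (2 : ℤ) :=
    KolyvaginLowerBoundAtTwo.torsionFixing_le_of_dvd W (by norm_num)
  have hpow : ∀ σ : absoluteGaloisGroup ℚ, ∃ i : ℕ, σ • ζ = ζ ^ i := fun σ ↦ by
    have h1 : (σ • ζ) ^ m = 1 := by rw [← smul_pow', hζ.pow_eq_one, smul_one]
    obtain ⟨i, -, hi⟩ := hζ.eq_pow_of_pow_eq_one h1
    exact ⟨i, hi.symm⟩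
  -- conjugates of `ζ`-fixing elements fix `ζ`
  have hconj : ∀ σ h : absoluteGaloisGroup ℚ, h • ζ = ζ → (σ * h * σ⁻¹) • ζ = ζ := by
    intro σ h hh
    obtain ⟨i, hi⟩ := hpow σ⁻¹
    rw [mul_smul, mul_smul, hi, smul_pow', hh, ← hi, smul_inv_smul]
  -- Step 1: some `h ∈ Γ_{ℚ(E[4], ζ)}` has `[x, h] ≠ 0`
  have step1 : ∃ h ∈ torsionFixing W (4 : ℤ), h • ζ = ζ ∧ h1Eval W (2 : ℤ) x h ≠ 0 := by
    by_contra hcon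
    push Not at hcon
    obtain ⟨ρ, hρ, hρv⟩ := hx
    apply hρv
    apply eq_zero_of_forall_smul_eq W hsurj
    intro γ
    have hc1 : γ * ρ * γ⁻¹ ∈ torsionFixing W (4 : ℤ) := (torsionFixing_normal W _).conj_mem ρ hρ γ
    have hcomm_fix : γ * ρ * γ⁻¹ * ρ⁻¹ ∈ torsionFixing W (4 : ℤ) := mul_mem hc1 (inv_mem hρ)
    have hcomm_ζ : (γ * ρ * γ⁻¹ * ρ⁻¹) • ζ = ζ := commutator_smul_rootOfUnity hζ γ ρ
    have h0 := hcon _ hcomm_fix hcomm_ζ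
    rw [h1Eval_mul W _ x (hT42 hc1), h1Eval_conj W _ x γ (hT42 hρ), h1Eval_inv W _ x (hT42 hρ),
      add_neg_eq_zero] at h0
    exact h0
  -- Step 2: `c₀` cannot fix every value
  by_contra hcon
  push Not at hcon
  obtain ⟨h₁, hh₁, hζ₁, hv₁⟩ := step1
  obtain ⟨v, hv⟩ : ∃ v : geomTorsion W (2 : ℤ), c₀ • v ≠ v :=
    KolyvaginEigenTwo.exists_twoTorsion_smul_ne_of_Δ_neg W hΔ hc₀
  apply hv
  by_cases hv0 : v = 0
  · rw [hv0, smul_zero]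
  have hsurj' : W.HasSurjectiveModNGaloisRep ((2 : ℕ) : ℤ) := by simpa using hsurj
  have h2Q : ((2 : ℕ) : ℚ) ≠ 0 := by norm_num
  obtain ⟨σ, hσ⟩ := exists_smul_eq_of_hasSurjectiveModNGaloisRep W 2 h2Q hsurj' hv₁ hv0
  have hmem : σ * h₁ * σ⁻¹ ∈ torsionFixing W (4 : ℤ) := (torsionFixing_normal W _).conj_mem h₁ hh₁ σ
  have hfix := hcon _ hmem (hconj σ h₁ hζ₁)
  rwa [h1Eval_conj W _ x σ (hT42 hh₁), hσ] at hfix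

end Key

/-! ## §53b Twisting primes whose Frobenius squares into `Γ_{ℚ(E[4])}` -/

section Main

variable (W : WeierstrassCurve ℚ) [W.IsElliptic]

/-- **TWISTING PRIMES WITH `Frob² ∈ Γ_{ℚ(E[4])}` (Čebotarev, proved in the tree).** Let `E = W/ℚ` be elliptic with `Δ(W) < 0` and
`ρ̄_{W,2}` onto, `c₀` a complex conjugation, `x ∈ H¹(ℚ, E[2])` NOT dying on `Γ_{ℚ(E[4])}`, `m ≥ 1`, `b` a bound. Then there is a prime
`ℓ > b`, `ℓ ∤ m`, with `m ∣ ℓ + 1`, an arithmetic Frobenius `F` at `ℓ` acting on `E[2]` as `c₀` with **`F² ∈ Γ_{ℚ(E[4])}`**, and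
`x_ℓ ≠ 0`. Proof = g7's `exists_twistingPrime` with the open set shrunk to `c₀h₀·(𝒩_x ∩ Γ_{ℚ(E[4])} ∩ Stab μ_m)`, `h₀ ∈ Γ_{ℚ(E[4], μ_m)}`
from §53a: the Frobenius `γ = c₀ t`, `t = h₀u ∈ Γ_{ℚ(E[4])}`, has `γ² = (c₀tc₀⁻¹)t ∈ Γ_{ℚ(E[4])}` and `[x, γ²] = c₀[x, h₀] + [x, h₀] ≠ 0`.
[cite: MazurRubin2010, Prop. 3.3 and Lemma 3.5] [cite: GrossLMS1991, §9 Prop. 9.6] [cite: McCallumLMS1991, §3 Cor. 3.2]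
[cite: SerreAbelianLadic1968, I §2.2] -/
theorem exists_twistingPrime_sq_mem_torsionFixing_four (hsurj : W.HasSurjectiveModNGaloisRep 2) (hΔ : W.Δ < 0)
    {c₀ : absoluteGaloisGroup ℚ} (hc₀ : IsComplexConjugation (Rat.castHom ℝ) c₀)
    {x : galH1Torsion W (2 : ℤ)} (hx : ∃ h ∈ torsionFixing W (4 : ℤ), h1Eval W (2 : ℤ) x h ≠ 0)
    {m : ℕ} (hm : m ≠ 0) (b : ℕ) :
    ∃ ℓ : ℕ, ∃ _ : Fact ℓ.Prime, b < ℓ ∧ ¬ ℓ ∣ m ∧ m ∣ ℓ + 1 ∧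
      (∃ (v : HeightOneSpectrum (𝓞 ℚ)) (𝔓 : Ideal (absIntegers (𝓞 ℚ) ℚ))
          (F : absoluteGaloisGroup ℚ), (ℓ : 𝓞 ℚ) ∈ v.asIdeal ∧ 𝔓 ∈ v.primesAbove ∧
          IsArithFrobAt (𝓞 ℚ) F 𝔓 ∧ (∀ P : geomTorsion W (2 : ℤ), F • P = c₀ • P) ∧
          F * F ∈ torsionFixing W (4 : ℤ)) ∧
      x ∉ W.torsionLocalKer ℚ_[ℓ] (2 : ℤ) := by
  classical
  haveI : NeZero m := ⟨hm⟩
  have hn0 : (2 : ℤ) ≠ 0 := two_ne_zero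
  have h40 : (4 : ℤ) ≠ 0 := by norm_num
  have hT42 : torsionFixing W (4 : ℤ) ≤ torsionFixing W (2 : ℤ) :=
    KolyvaginLowerBoundAtTwo.torsionFixing_le_of_dvd W (by norm_num)
  -- a primitive `m`-th root of unity in `ℚ̄`
  have hq0 : ((m : ℕ) : AlgebraicClosure ℚ) ≠ 0 := by exact_mod_cast hm
  haveI : NeZero ((m : ℕ) : AlgebraicClosure ℚ) := ⟨hq0⟩
  obtain ⟨ζ, hζ⟩ := IsAlgClosed.exists_root (Polynomial.cyclotomic m (AlgebraicClosure ℚ))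
    (Polynomial.degree_cyclotomic_pos m _ (Nat.pos_of_ne_zero hm)).ne'
  have hprim : IsPrimitiveRoot ζ m := Polynomial.isRoot_cyclotomic_iff.mp hζ
  -- ### the key lemma at level `4`
  obtain ⟨h₀, hh₀T4, hh₀ζ, hh₀v⟩ := exists_torsionFixing_four_smul_h1Eval_ne W hsurj hΔ hc₀ hx hprim
  have hh₀T : h₀ ∈ torsionFixing W (2 : ℤ) := hT42 hh₀T4
  -- ### the finite exceptional set of places of `ℚ`
  set B : Finset ℕ := m.primeFactors ∪ Finset.range (b + 1) with hB
  set S : Set (HeightOneSpectrum (𝓞 ℚ)) := {v | ∃ q ∈ B, q.Prime ∧ (q : 𝓞 ℚ) ∈ v.asIdeal}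
    with hS
  have hSfin : S.Finite := by
    have : S ⊆ ⋃ q ∈ (B.filter Nat.Prime), {v | (q : 𝓞 ℚ) ∈ v.asIdeal} := by
      intro v ⟨q, hqB, hq, hqv⟩
      simp only [Set.mem_iUnion, Finset.mem_filter]
      exact ⟨q, ⟨hqB, hq⟩, hqv⟩
    refine Set.Finite.subset (Set.Finite.biUnion (Finset.finite_toSet _) fun q hq ↦ ?_) this
    rw [Finset.coe_filter, Set.mem_setOf_eq] at hq
    have hsub : {v : HeightOneSpectrum (𝓞 ℚ) | (q : 𝓞 ℚ) ∈ v.asIdeal}.Subsingleton :=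
      fun v hv v' hv' ↦ HeightOneSpectrum.eq_of_natCast_mem_rat hq.2 hv hv'
    exact hsub.finite
  -- ### Čebotarev: a Frobenius in the open set `c₀ h₀ · (𝒩 ∩ Γ_{ℚ(E[4])} ∩ Stab ζ)`
  set 𝒩 := evalKer W (2 : ℤ) (fun _ : Unit ↦ x) with h𝒩
  have h𝒩open : IsOpen (𝒩 : Set (absoluteGaloisGroup ℚ)) :=
    isOpen_evalKer W _ _ (isOpen_torsionFixing W hn0)
  have hT4open : IsOpen (torsionFixing W (4 : ℤ) : Set (absoluteGaloisGroup ℚ)) := isOpen_torsionFixing W h40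
  set A : Subgroup (absoluteGaloisGroup ℚ) := MulAction.stabilizer (absoluteGaloisGroup ℚ) ζ with hA
  have hAopen : IsOpen (A : Set (absoluteGaloisGroup ℚ)) := by
    haveI : FiniteDimensional ℚ (IntermediateField.adjoin ℚ {ζ}) :=
      IntermediateField.adjoin.finiteDimensional
        ((AlgebraicClosure.isAlgebraic ℚ).isAlgebraic ζ).isIntegral
    refine Subgroup.isOpen_mono (H₁ := (IntermediateField.adjoin ℚ {ζ}).fixingSubgroup) ?_
      (IntermediateField.fixingSubgroup_isOpen _)
    intro σ hσ
    rw [IntermediateField.mem_fixingSubgroup_iff] at hσ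
    exact hσ ζ (IntermediateField.mem_adjoin_simple_self ℚ ζ)
  set U : Set (absoluteGaloisGroup ℚ) :=
    ((𝒩 : Set _) ∩ (torsionFixing W (4 : ℤ) : Set (absoluteGaloisGroup ℚ))) ∩ (A : Set _) with hU
  have hUopen : IsOpen U := (h𝒩open.inter hT4open).inter hAopen
  set O : Set (absoluteGaloisGroup ℚ) := (fun γ ↦ c₀ * h₀ * γ) '' U with hO
  have hOopen : IsOpen O := (Homeomorph.mulLeft (c₀ * h₀)).isOpenMap _ hUopen
  have hOne : O.Nonempty := ⟨c₀ * h₀ * 1, 1, ⟨⟨𝒩.one_mem, (torsionFixing W (4 : ℤ)).one_mem⟩, A.one_mem⟩, rfl⟩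
  obtain ⟨γ, hγO, v, hvS, 𝔓₀, h𝔓₀, hγ⟩ :=
    (absoluteGaloisGroup.frobenius_dense Automorphic.chebotarev_artinRep_holds ℚ S hSfin
      ).inter_open_nonempty O hOopen hOne
  obtain ⟨u, ⟨⟨hu𝒩, huT4⟩, huA⟩, rfl⟩ := hγO
  have hux : h1Eval W (2 : ℤ) x u = 0 := hu𝒩.2 ()
  have huζ : u • ζ = ζ := huA
  set t := h₀ * u with ht
  have htT4 : t ∈ torsionFixing W (4 : ℤ) := mul_mem hh₀T4 huT4
  have htT : t ∈ torsionFixing W (2 : ℤ) := hT42 htT4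
  have hγt : c₀ * h₀ * u = c₀ * t := by rw [ht, mul_assoc]
  -- ### the rational prime `ℓ` under `v` and `ℚ_v ≅ ℚ_ℓ`
  set ℓ : ℕ := (Rat.HeightOneSpectrum.primesEquiv (R := 𝓞 ℚ) v : ℕ) with hℓdef
  have hℓ : ℓ.Prime := (Rat.HeightOneSpectrum.primesEquiv (R := 𝓞 ℚ) v).2
  haveI hℓF : Fact ℓ.Prime := ⟨hℓ⟩
  have hℓv : (ℓ : 𝓞 ℚ) ∈ v.asIdeal := by
    have h := (Rat.HeightOneSpectrum.natGenerator_dvd_iff (R := 𝓞 ℚ) v (n := ℓ)).mp dvd_rfl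
    rw [Ideal.mem_map_iff_of_surjective _ (Rat.IsIntegralClosure.intEquiv (𝓞 ℚ)).surjective] at h
    obtain ⟨y, hy, hyℓ⟩ := h
    have : y = (ℓ : 𝓞 ℚ) := (Rat.IsIntegralClosure.intEquiv (𝓞 ℚ)).injective (by rw [hyℓ, map_natCast])
    rwa [this] at hy
  haveI : CharZero (v.adicCompletion ℚ) :=
    charZero_of_injective_algebraMap (algebraMap ℚ (v.adicCompletion ℚ)).injective
  set θ : v.adicCompletion ℚ ≃+* ℚ_[ℓ] :=
    RingEquivClass.toRingEquiv (Rat.HeightOneSpectrum.adicCompletion.padicEquiv (R := 𝓞 ℚ) v)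
    with hθ
  have hℓB : ℓ ∉ B := fun h ↦ hvS ⟨ℓ, h, hℓ, hℓv⟩
  simp only [hB, Finset.mem_union, Nat.mem_primeFactors, Finset.mem_range, not_or] at hℓB
  obtain ⟨hℓm', hℓb⟩ := hℓB
  have hℓm : ¬ ℓ ∣ m := fun h ↦ hℓm' ⟨hℓ, h, hm⟩
  have hbℓ : b < ℓ := by omega
  -- ### `m ∣ ℓ + 1`: the Frobenius inverts `ζ` (as `c₀` does) and raises it to the `ℓ`-th power
  have hmv : (m : 𝓞 ℚ) ∉ v.asIdeal := natCast_not_mem_of_not_dvd hℓ hℓv hℓm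
  have h1 : (c₀ * h₀ * u) • ζ = ζ⁻¹ := by
    rw [mul_smul, mul_smul, huζ, hh₀ζ, RatClosure.smul_eq_inv_of_pow_eq_one hc₀ hm hprim.pow_eq_one]
  have h2 : (c₀ * h₀ * u) • ζ = ζ ^ v.residueCard :=
    smul_eq_pow_residueCard_of_isArithFrobAt_of_pow_eq_one hmv h𝔓₀ hγ hprim.pow_eq_one
  rw [residueCard_eq_of_natCast_mem_rat hℓ hℓv, h1] at h2
  have hζ0 : ζ ≠ 0 := hprim.ne_zero hm
  have hζ1 : ζ ^ (ℓ + 1) = 1 := by rw [pow_succ, ← h2, inv_mul_cancel₀ hζ0]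
  have hmdvd : m ∣ ℓ + 1 := (hprim.pow_eq_one_iff_dvd (ℓ + 1)).mp hζ1
  -- ### the Frobenius acts on `E[2]` as `c₀`, and squares into `Γ_{ℚ(E[4])}`
  have hFE : ∀ P : geomTorsion W (2 : ℤ), (c₀ * h₀ * u) • P = c₀ • P := fun P ↦ by
    rw [hγt, mul_smul, smul_eq_of_mem_torsionFixing W _ htT]
  have hsq : c₀ * c₀ = 1 := by have h := hc₀.sq_eq_one; rwa [sq] at h
  have hFF : (c₀ * h₀ * u) * (c₀ * h₀ * u) ∈ torsionFixing W (4 : ℤ) := by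
    rw [hγt]; exact conj_mul_mul_self_mem_torsionFixing W hsq htT4
  -- ### `[x, γ²] = c₀ [x, h₀] + [x, h₀] ≠ 0`
  have hcinv : c₀⁻¹ = c₀ := inv_eq_of_mul_eq_one_right hsq
  have hγγ : (c₀ * h₀ * u) * (c₀ * h₀ * u) = (c₀ * t * c₀⁻¹) * t := by
    rw [hγt, hcinv]; group
  have hconjT : c₀ * t * c₀⁻¹ ∈ torsionFixing W (2 : ℤ) := (torsionFixing_normal W _).conj_mem t htT c₀
  have hγγT : (c₀ * h₀ * u) * (c₀ * h₀ * u) ∈ torsionFixing W (2 : ℤ) := by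
    rw [hγγ]; exact mul_mem hconjT htT
  have hval : h1Eval W (2 : ℤ) x ((c₀ * h₀ * u) * (c₀ * h₀ * u)) ≠ 0 := by
    rw [hγγ, h1Eval_mul W _ x hconjT, h1Eval_conj W _ x c₀ htT, ht, h1Eval_mul W _ x hh₀T, hux,
      add_zero]
    intro h0
    apply hh₀v
    have h2v : h1Eval W (2 : ℤ) x h₀ + h1Eval W (2 : ℤ) x h₀ = 0 := by
      rw [← two_nsmul]; exact AddSubgroup.torsionBy.nsmul _
    rw [eq_neg_of_add_eq_zero_left h0, neg_eq_of_add_eq_zero_left h2v]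
  -- ### the local criterion at `v`, then transport to `ℚ_ℓ`
  have hloc := not_mem_torsionLocalKer_of_h1Eval_sq_ne_zero W (n := 2) two_ne_zero h𝔓₀ hγ hγγT hval
  refine ⟨ℓ, hℓF, hbℓ, hℓm, hmdvd, ⟨v, 𝔓₀, c₀ * h₀ * u, hℓv, h𝔓₀, hγ, hFE, hFF⟩, fun hx' ↦ hloc ?_⟩
  exact (mem_torsionLocalKer_padic_iff W θ (2 : ℤ) x).mp hx'

end Main

/-! ## §53c Entangled minimal prime Heegner twins exist for every Selmer-entangled row-1 curve -/

section Entangled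

variable (W : WeierstrassCurve ℚ) [W.IsElliptic] [W.IsGloballyMinimal]

/-- **ENTANGLED MINIMAL PRIME HEEGNER TWINS EXIST FOR EVERY SELMER-ENTANGLED ROW-1 CURVE.** `W/ℚ` globally minimal, `Δ_W < 0`, `ρ̄_{W,2}` and
`ρ_{W,4}` onto, `#Sel₂(W) = 4`, and some non-zero class of `Sel₂(W)` dies on `Γ_{ℚ(E[4])}` («Selmer-entangled»; by g8 + §51 that class is the
level-`4` class `ξ_W`); displayed facts: Poitou–Tate duality for Selmer structures and Tate's local Euler characteristic. Then beyond every bound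
`b` there are a prime `ℓ₀ ≡ 7 (mod 8)`, `ℓ₀ ∤ 2N_W`, the prime Heegner field `K = ℚ(√−ℓ₀)` with every `K`-clause of crux 22136 (odd `d_K ≠ −3`,
Heegner, the two non-square clauses, `2` split, DEF `= 1`), and a globally minimal model `Wd` of `W^{(d_K)}` with `#Sel₂(Wd) = 2` which is
ENTANGLED: for every `P ∈ Wd(ℚ)` and every half `Q` of it no `E[2]`-translate of which is rational, EVERY `h ∈ Γ_{ℚ(E[4])}` FIXES `Q`.
Proof: a Selmer class `c` not dying on `Γ_{ℚ(E[4])}` exists (g8 `exists_selmer_h1Eval_ne_four_of_card_eq_four`); §53b gives a twisting prime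
`ℓ₀` for `c` (`8N ∣ ℓ₀ + 1`) whose Frobenius is `c₀` on `E[2]` and squares into `Γ_{ℚ(E[4])}`; `Sel₂(W)` is then non-strict at `ℓ₀`, so
gk2-p5's DOWN supply (`GenusKolyTwin.supply_DEF1_of_not_strict_prime_of_duality`) yields `K` and the minimal twin; and §52c
(`forall_torsionFixing_four_smul_eq_of_selmer_entangled_of_sq_mem_torsionFixing_four`) makes it entangled.
[cite: MazurRubin2010, Prop. 3.3, Cor. 3.4 (i), Lemma 3.5] [cite: LawsonWuthrich2016, §3] [cite: GrossLMS1991, §9 Prop. 9.6] -/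
theorem exists_prime_heegnerField_minimalTwin_entangled_of_selmer_entangled
    (hPT : poitouTate_selmerStructure_duality_real ℚ)
    (hEP : ∀ v : HeightOneSpectrum (𝓞 ℚ), localEulerPoincareCharacteristic (v.adicCompletion ℚ))
    (hΔ : W.Δ < 0) (hsurj : W.HasSurjectiveModNGaloisRep 2) (hsurj4 : W.HasSurjectiveModNGaloisRep 4)
    (h4 : Nat.card (W.selmerGroup 2) = 4)
    (hent : ∃ y ∈ W.selmerGroup 2, y ≠ 0 ∧ ∀ h ∈ torsionFixing W (4 : ℤ), h1Eval W (2 : ℤ) y h = 0) (b : ℕ) :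
    ∃ ℓ₀ : ℕ, ℓ₀.Prime ∧ b < ℓ₀ ∧ ℓ₀ % 8 = 7 ∧ ¬ ℓ₀ ∣ 2 * W.conductorNorm ℤ ∧
      ∃ (K : Type) (_ : Field K) (_ : NumberField K), IsImaginaryQuadratic K ∧ discr K = -(ℓ₀ : ℤ) ∧ Odd (discr K) ∧
        discr K ≠ -3 ∧ SatisfiesHeegnerHypothesis (W.conductorNorm ℤ) K ∧
        ¬ IsSquare ((discr K : ℚ) * -|W.Δ|) ∧ ¬ IsSquare ((discr K : ℚ) * (-(2 * |W.Δ|))) ∧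
        ((Ideal.span {(2 : ℤ)}).primesOver (𝓞 K)).ncard = 2 ∧
        (∃! x : ZMod ℓ₀, 4 * x ^ 3 + ((integralModelInt W).b₂ : ZMod ℓ₀) * x ^ 2 +
          2 * ((integralModelInt W).b₄ : ZMod ℓ₀) * x + ((integralModelInt W).b₆ : ZMod ℓ₀) = 0) ∧
        ∃ (Wd : WeierstrassCurve ℚ) (_ : Wd.IsElliptic) (_ : Wd.IsGloballyMinimal),
          (∃ C : VariableChange ℚ, C • W.quadraticTwist (discr K : ℚ) = Wd) ∧ Nat.card (Wd.selmerGroup 2) = 2 ∧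
          ∀ (P : Wd.toAffine.Point) (Q : geomPoints Wd), (2 : ℤ) • Q = toGeomPoints Wd P →
            (∀ T ∈ geomTorsion Wd (2 : ℤ), Q - T ∉ MulAction.fixedPoints (absoluteGaloisGroup ℚ) (geomPoints Wd)) →
            ∀ h ∈ torsionFixing W (4 : ℤ), h • Q = Q := by
  have hN : W.conductorNorm ℤ ≠ 0 := (W.conductorNorm_pos_holds).ne'
  have hm : 8 * W.conductorNorm ℤ ≠ 0 := by positivity
  obtain ⟨c₀, hc₀⟩ := exists_isComplexConjugation (Rat.castHom ℝ)
  -- a Selmer class NOT dying on `Γ_{ℚ(E[4])}`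
  obtain ⟨c, hcS, hρ, hρT, hcρ⟩ := exists_selmer_h1Eval_ne_four_of_card_eq_four W hsurj hsurj4 h4
  have e4 : ((2 ^ 2 : ℕ) : ℤ) = 4 := by norm_num
  rw [e4] at hρT
  -- a twisting prime for `c` whose Frobenius squares into `Γ_{ℚ(E[4])}`
  obtain ⟨ℓ, hℓF, hbℓ, hℓm, hmdvd, ⟨v, 𝔓₀, F, hℓv, h𝔓₀, hF, hFE, hFF⟩, hloc⟩ :=
    exists_twistingPrime_sq_mem_torsionFixing_four W hsurj hΔ hc₀ ⟨hρ, hρT, hcρ⟩ hm b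
  haveI := hℓF
  have hℓ : ℓ.Prime := hℓF.out
  have hℓN : ¬ ℓ ∣ 2 * W.conductorNorm ℤ := fun h ↦ hℓm (h.trans ⟨4, by ring⟩)
  have hℓ8 : ℓ % 8 = 7 := by
    have h8 : 8 ∣ ℓ + 1 := (Dvd.intro (W.conductorNorm ℤ) rfl).trans hmdvd
    omega
  have hℓp : ∀ p : ℕ, p ∣ W.conductorNorm ℤ → p ∣ ℓ + 1 := fun p hp ↦ (Dvd.dvd.mul_left hp 8).trans hmdvd
  have hns : ¬ W.selmerGroup 2 ≤ MazurRubin2010.strictLocalKer W ℚ_[ℓ] 2 := fun hle ↦ hloc (hle hcS)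
  have hℓN' : ∀ p : ℕ, p.Prime → p ∣ W.conductorNorm ℤ → p ≠ 2 → (ℓ : ZMod p) = -1 := by
    intro p _ hp _
    have h : ((ℓ + 1 : ℕ) : ZMod p) = 0 := (ZMod.natCast_eq_zero_iff _ _).mpr (hℓp p hp)
    rw [Nat.cast_add, Nat.cast_one] at h
    exact eq_neg_of_add_eq_zero_left h
  obtain ⟨K, _, _, hK, hd, hodd, hd3, hH, hsq1, hsq2, h2K, hDEF, Wd, _, _, hWd, hSelWd⟩ :=
    GenusKolyTwin.supply_DEF1_of_not_strict_prime_of_duality W hPT hEP hΔ h4 hℓ8 hℓN' hns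
  -- the Frobenius moves `E[2]` (it is `c₀` there, and `Δ < 0`)
  have hFT : ∃ T : geomTorsion W (2 : ℤ), F • T ≠ T := by
    obtain ⟨T, hT⟩ := KolyvaginEigenTwo.exists_twoTorsion_smul_ne_of_Δ_neg W hΔ hc₀
    exact ⟨T, fun h ↦ hT ((hFE T).symm.trans h)⟩
  refine ⟨ℓ, hℓ, hbℓ, hℓ8, hℓN, K, inferInstance, inferInstance, hK, hd, hodd, hd3, hH, hsq1, hsq2, h2K, hDEF, Wd,
    inferInstance, inferInstance, hWd, hSelWd, fun P Q hQ hP ↦ ?_⟩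
  obtain ⟨C, hC⟩ := hWd
  exact forall_torsionFixing_four_smul_eq_of_selmer_entangled_of_sq_mem_torsionFixing_four W hΔ hK hodd hH h2K hd hC hSelWd
    P Q hQ hP hℓv h𝔓₀ hF hFF hFT hent

end Entangled

end Summit.BirchSwinnertonDyer.BirchSwinnertonDyer.Theorems.GenusKolyTwistingPrime

end
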